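import Literature.NumberTheory.EllipticCurves.Kato2004.UniversalNormsTools
import Literature.NumberTheory.EllipticCurves.GaloisActionProofs
import Literature.NumberTheory.EllipticCurves.ZpExtensionUnramifiedProofs
import Literature.NumberTheory.GaloisRepresentations.InertiaCohomologyFinite
import Literature.NumberTheory.GaloisRepresentations.DecompositionGroupOfCompletion
import Literature.NumberTheory.GaloisRepresentations.LAdicCharacterUnramifiedAEProofs
import Literature.NumberTheory.GaloisRepresentations.IntegralGaloisActionProofs
import Literature.NumberTheory.GaloisRepresentations.AbsGaloisOuterConj
import Literature.NumberTheory.Automorphic.AdicCompletionLocalField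
import HarnessLib

/-!
# Kato 2004 (Astérisque 295) Lemma 8.5 (2), tools II: `H¹(I_𝔓, W[p])` is finite and
# `H¹(I_𝔓, T_pW)/p^m` has finitely many residues

Topic `NumberTheory/EllipticCurves`, sub-directory `Kato2004` (namespace = path, sub-namespace
`UniversalNorms`).  Cell `bsd-smallim` (rung K6 of `BirchSwinnertonDyer`), seat `bsd-smallim-k6-lur-a`
(gen 3).  THEOREMS ONLY (no definition, no named fact, no `sorry`).  Second file towards the discharge of
the named fact `Kato2004.mem_integralH1_of_forall_layerCores_eq` (Kato's Lemma 8.5 (2) on the pin,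
strong form); it supplies the FINITENESS input replacing the Frobenius-weight argument of the printed
proof (Kato p. 184: "`H¹(O_v, T) = H¹(Gal(K_v^{ur}/K_v), H⁰(K_v^{ur}, T))` … the cokernel of
`H¹(O_v, T) → H¹(K_v, T)` injects into `H⁰(𝔽_v, H¹(K_v^{ur}, T))`", a finitely generated `ℤ_p`-module):

* §1 `finite_H1_torsionGaloisModule_inertia` — for a rational prime `v ≠ p` and a prime `𝔓 ∣ v` of
  `ℤ̄`, **`H¹(I_𝔓, W[p])` is finite**.  The tree's LOCAL theorem
  `natCard_continuousCohomology_one_absInertia_le` (`#H¹(I_F, B) ≤ #B` for a finite discrete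
  `Γ_F`-module `B` of order prime to the residue characteristic, `F = ℚ_v`) is transported to the global
  inertia group along `θ = ρ₀ · res(·) · ρ₀⁻¹ : Γ_{ℚ_v} → Γ_ℚ` (`I_{𝔓₀} = res(I_{ℚ_v})`, Neukirch II (9.6),
  tree `inertia_adicCompletionPrime_eq_map_absInertia`; `𝔓 = ρ₀ 𝔓₀`, Neukirch I (9.1)): `θ` maps `I_{ℚ_v}`
  ONTO `I_𝔓`, so the pull-back `H¹(I_𝔓, W[p]) → H¹(I_{ℚ_v}, W[p])` is injective.
* §2 `finite_H1_torsionGaloisModule_inf_inertia` — the same for `U ⊓ I_𝔓` when `I_𝔓 ≤ U` (restriction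
  between subgroups with the same elements is injective, tools I).
* §3 `exists_finset_forall_sub_mem_pow_smul` — **`M/p^m M` is finite** for `M = H¹(U ⊓ I_𝔓, T_pW)`,
  `I_𝔓 ≤ U`: there is a finite set `S ⊆ M` with every `x ∈ M` congruent to some `s ∈ S` modulo `p^m M`
  (`m = 1`: `M/pM ↪ H¹(U ⊓ I_𝔓, W[p])`, k6-g4's `reduceH1_eq_zero_iff`; induction on `m`).

References: K. Kato, Astérisque 295 (2004), §8.2 and Lemma 8.5 (pp. 180–184) [Kato2004Asterisque];
J. Neukirch, *Algebraic Number Theory* (1999), Ch. I §9 (9.1), Ch. II §9 (9.6) [NeukirchANT1999];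
J. S. Milne, *Arithmetic Duality Theorems* (2006), I §2 Lemma 2.9 [MilneADT2006]; J.-P. Serre, *Galois
Cohomology* (1997), I §2, II §5.5 [SerreGaloisCohomology1997].
-/

noncomputable section

open scoped NumberField Pointwise Valued
open CategoryTheory Field IsDedekindDomain ValuativeRel
open Literature.NumberTheory.GaloisRepresentations
open Literature.NumberTheory.EllipticCurves
open Literature.NumberTheory.EllipticCurves.Kato2004
open Literature.NumberTheory.EllipticCurves.Kato2004.EulerSystemValues
open WeierstrassCurve (geomPoints geomTorsion)

namespace Literature.NumberTheory.EllipticCurves.Kato2004.UniversalNorms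

variable (W : WeierstrassCurve ℚ) [W.IsElliptic] (p : ℕ) [Fact p.Prime]

/-! ## §1 `H¹(I_𝔓, W[p])` is finite -/

/-- **`H¹(I_𝔓, W[p])` is finite** for every prime `𝔓` of `ℤ̄` above a rational prime `v ≠ p`
(continuous cohomology of the inertia group `I_𝔓 ≤ Γ_ℚ` with values in the discrete module
`W[p] = E(ℚ̄)[p]`).  PROOF: the homomorphism `θ = ρ₀ res(·) ρ₀⁻¹ : Γ_{ℚ_v} → Γ_ℚ` (`ρ₀ 𝔓₀ = 𝔓`, `𝔓₀`
the prime cut out by `ℚ̄ → ℚ̄_v`) maps the local inertia group `I_{ℚ_v}` ONTO `I_𝔓`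
(`inertia_adicCompletionPrime_eq_map_absInertia`), so pulling back classes along `θ` embeds
`H¹(I_𝔓, W[p])` into `H¹(I_{ℚ_v}, W[p]|θ)`, which is finite of order `≤ #W[p] = p²` because `p²` is
prime to the residue characteristic `v` (`natCard_continuousCohomology_one_absInertia_le`, Milne ADT
I Lemma 2.9 / Serre CG II §5.5).
[cite: MilneADT2006, I §2 Lemma 2.9] [cite: NeukirchANT1999, Ch. II §9 Prop. (9.6)] -/
theorem finite_H1_torsionGaloisModule_inertia {v : HeightOneSpectrum (𝓞 ℚ)}
    (hv : (p : 𝓞 ℚ) ∉ v.asIdeal) {𝔓 : Ideal (absIntegers (𝓞 ℚ) ℚ)} (h𝔓 : 𝔓 ∈ v.primesAbove) :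
    Finite (H1 (W.torsionGaloisModule (p : ℤ)) (𝔓.inertia (absoluteGaloisGroup ℚ))) := by
  classical
  have hp : p.Prime := Fact.out
  -- `𝔓 = ρ₀ • 𝔓₀`
  have h𝔓₀ : adicCompletionPrime ℚ v ∈ v.primesAbove := adicCompletionPrime_mem_primesAbove ℚ v
  obtain ⟨ρ₀, hρ₀⟩ := HeightOneSpectrum.exists_smul_eq_of_mem_primesAbove_holds h𝔓₀ h𝔓
  -- `θ : Γ_{ℚ_v} → Γ_ℚ`, `x ↦ ρ₀ res(x) ρ₀⁻¹`
  let res₀ := absGaloisRestrict ℚ (v.adicCompletion ℚ)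
  let θ : absoluteGaloisGroup (v.adicCompletion ℚ) →ₜ* absoluteGaloisGroup ℚ :=
    { toFun := fun x => ρ₀ * res₀ x * ρ₀⁻¹
      map_one' := by simp
      map_mul' := fun a b => by rw [map_mul]; group
      continuous_toFun := (continuous_const.mul res₀.continuous).mul continuous_const }
  have hθ : ∀ x, θ x = ρ₀ * res₀ x * ρ₀⁻¹ := fun _ => rfl
  -- `θ (I_{ℚ_v}) = I_𝔓`
  have hθI : ∀ x ∈ absInertia (v.adicCompletion ℚ), θ x ∈ 𝔓.inertia (absoluteGaloisGroup ℚ) := by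
    intro x hx
    have h1 : res₀ x ∈ (adicCompletionPrime ℚ v).inertia (absoluteGaloisGroup ℚ) := by
      rw [inertia_adicCompletionPrime_eq_map_absInertia]
      exact ⟨x, hx, rfl⟩
    rw [hθ, ← hρ₀]
    exact (Ideal.conj_mem_inertia_smul_iff _ ρ₀ (res₀ x)).mpr h1
  have hθsurj : ∀ γ ∈ 𝔓.inertia (absoluteGaloisGroup ℚ),
      ∃ x ∈ absInertia (v.adicCompletion ℚ), θ x = γ := by
    intro γ hγ
    rw [← hρ₀] at hγ
    have h2 : ρ₀⁻¹ * γ * ρ₀ ∈ (adicCompletionPrime ℚ v).inertia (absoluteGaloisGroup ℚ) :=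
      (HeightOneSpectrum.mem_inertia_smul_absIntegers_iff ρ₀ _ _).mp hγ
    rw [inertia_adicCompletionPrime_eq_map_absInertia] at h2
    obtain ⟨x, hx, hxe⟩ := Subgroup.mem_map.mp h2
    refine ⟨x, hx, ?_⟩
    rw [hθ, show res₀ x = ρ₀⁻¹ * γ * ρ₀ from hxe]
    group
  -- the restriction of `θ` to the inertia groups
  let θI : absInertia (v.adicCompletion ℚ) →ₜ* 𝔓.inertia (absoluteGaloisGroup ℚ) :=
    { toFun := fun x => ⟨θ x, hθI x x.2⟩
      map_one' := Subtype.ext (by simp)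
      map_mul' := fun a b => Subtype.ext (by simp)
      continuous_toFun := Continuous.subtype_mk (θ.continuous.comp continuous_subtype_val) _ }
  -- the local representation `W[p]|θ` and the finiteness of `H¹(I_{ℚ_v}, W[p]|θ)`
  let ρl : ContinuousRep (absoluteGaloisGroup (v.adicCompletion ℚ)) ℤ (geomTorsion W (p : ℤ)) :=
    (W.torsionGaloisModule (p : ℤ)).restrict θ
  haveI : Finite (geomTorsion W (p : ℤ)) :=
    WeierstrassCurve.finite_torsionPoints_holds W (AlgebraicClosure ℚ) (by exact_mod_cast hp.ne_zero)
  have hcard : Nat.card (geomTorsion W (p : ℤ)) = p ^ 2 := by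
    have hNF : ((p : ℕ) : AlgebraicClosure ℚ) ≠ 0 := by exact_mod_cast hp.ne_zero
    exact WeierstrassCurve.card_torsionPoints_eq_sq_holds W (AlgebraicClosure ℚ) hNF
  have hq := not_ringChar_residueField_adicCompletion_dvd_of_not_mem (K := ℚ) (ℓ := p) hv
  have hqprime := ringChar_residueField_prime (F := v.adicCompletion ℚ)
  obtain ⟨hfin, -⟩ := natCard_continuousCohomology_one_absInertia_le (v.adicCompletion ℚ) ρl (by
    rw [hcard]
    exact Nat.Coprime.pow_left 2 (Nat.coprime_comm.mp ((Nat.Prime.coprime_iff_not_dvd hqprime).mpr hq)))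
  -- the pull-back `H¹(I_𝔓, W[p]) → H¹(I_{ℚ_v}, W[p]|θ)` is injective
  let fI : TopRep.res (θI : absInertia (v.adicCompletion ℚ) →* 𝔓.inertia (absoluteGaloisGroup ℚ))
      (subgroupRep (W.torsionGaloisModule (p : ℤ)).toTopRep (𝔓.inertia (absoluteGaloisGroup ℚ))) ⟶
      (ρl.restrict (subgroupIncl (absInertia (v.adicCompletion ℚ)))).toTopRep :=
    TopRep.ofHom ⟨ContinuousLinearMap.id ℤ _, fun _ => rfl⟩
  let pull := ContinuousCohomology.map θI fI 1
  have key : ∀ c, pull c = 0 → c = 0 := by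
    intro c hc
    obtain ⟨φ, rfl⟩ := oneCocycleClass_surjective _ c
    change ContinuousCohomology.map θI fI 1 (oneCocycleClass _ φ) = 0 at hc
    rw [map_oneCocycleClass, oneCocycleClass_eq_zero_iff] at hc
    obtain ⟨b, hb⟩ := hc
    rw [oneCocycleClass_eq_zero_iff]
    refine ⟨b, fun γ => ?_⟩
    obtain ⟨x, hx, hxγ⟩ := hθsurj γ γ.2
    have e : θI ⟨x, hx⟩ = γ := Subtype.ext hxγ
    have hbx := hb ⟨x, hx⟩
    rw [contOneCocycles.pullback_apply, TopRep.hom_ofHom, e] at hbx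
    change φ.1 γ = (θ x) • b - b at hbx
    change φ.1 γ = ((γ : absoluteGaloisGroup ℚ)) • b - b
    rw [hbx, hxγ]
  have hinj : Function.Injective pull := by
    intro a b hab
    have h0 : pull (a - b) = 0 := by rw [map_sub, hab, sub_self]
    exact sub_eq_zero.mp (key _ h0)
  exact @Finite.of_injective _ _ hfin pull hinj

/-! ## §2 The same for `U ⊓ I_𝔓` when `I_𝔓 ≤ U` -/

variable [ContinuousSMul ℤ_[p] (W.tateModule p)]

omit [ContinuousSMul ℤ_[p] (W.tateModule p)] in
/-- `H¹(U ⊓ I_𝔓, W[p])` is finite when `I_𝔓 ≤ U` (`U ⊓ I_𝔓` and `I_𝔓` have the same elements, so the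
restriction `H¹(U ⊓ I_𝔓, ·) → H¹(I_𝔓, ·)` is injective, `resLe_injective_of_le`).
[cite: MilneADT2006, I §2 Lemma 2.9] -/
theorem finite_H1_torsionGaloisModule_inf_inertia {v : HeightOneSpectrum (𝓞 ℚ)}
    (hv : (p : 𝓞 ℚ) ∉ v.asIdeal) {𝔓 : Ideal (absIntegers (𝓞 ℚ) ℚ)} (h𝔓 : 𝔓 ∈ v.primesAbove)
    {U : Subgroup (absoluteGaloisGroup ℚ)} (hIU : 𝔓.inertia (absoluteGaloisGroup ℚ) ≤ U) :
    Finite (H1 (W.torsionGaloisModule (p : ℤ)) (U ⊓ 𝔓.inertia (absoluteGaloisGroup ℚ))) := by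
  haveI := finite_H1_torsionGaloisModule_inertia W p hv h𝔓
  have h : 𝔓.inertia (absoluteGaloisGroup ℚ) ≤ U ⊓ 𝔓.inertia (absoluteGaloisGroup ℚ) :=
    fun g hg => ⟨hIU hg, hg⟩
  exact Finite.of_injective _
    (resLe_injective_of_le (W.torsionGaloisModule (p : ℤ)).toTopRep h inf_le_right)

/-! ## §3 `H¹(U ⊓ I_𝔓, T_pW)/p^m` has finitely many residues -/

/-- **`M/pM` is finite**, `M = H¹(U ⊓ I_𝔓, T_pW)`, `I_𝔓 ≤ U`, `𝔓 ∣ v ≠ p`: there is a finite set `S ⊆ M`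
such that every `x ∈ M` is congruent modulo `p M` to some `s ∈ S` — the reduction
`red : M → H¹(U ⊓ I_𝔓, W[p])` has finite target (§2) and kernel `p M`
(`Kato2004.reduceH1_eq_zero_iff`, Kato §13.8 levelwise). [cite: Kato2004Asterisque, §13.8 (pp. 228–229)]
[cite: MilneADT2006, I §2 Lemma 2.9] -/
theorem exists_finset_forall_sub_eq_smul {v : HeightOneSpectrum (𝓞 ℚ)}
    (hv : (p : 𝓞 ℚ) ∉ v.asIdeal) {𝔓 : Ideal (absIntegers (𝓞 ℚ) ℚ)} (h𝔓 : 𝔓 ∈ v.primesAbove)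
    {U : Subgroup (absoluteGaloisGroup ℚ)} (hIU : 𝔓.inertia (absoluteGaloisGroup ℚ) ≤ U) :
    ∃ S : Finset (H1 (tateRep W p) (U ⊓ 𝔓.inertia (absoluteGaloisGroup ℚ))),
      ∀ x, ∃ s ∈ S, ∃ y : H1 (tateRep W p) (U ⊓ 𝔓.inertia (absoluteGaloisGroup ℚ)),
        x - s = (p : ℤ_[p]) • y := by
  classical
  haveI := finite_H1_torsionGaloisModule_inf_inertia W p hv h𝔓 hIU
  haveI := Fintype.ofFinite (H1 (W.torsionGaloisModule (p : ℤ)) (U ⊓ 𝔓.inertia (absoluteGaloisGroup ℚ)))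
  set red := reduceH1 W p (U ⊓ 𝔓.inertia (absoluteGaloisGroup ℚ))
  -- a section of `red` over its (finite) range
  let sec : H1 (W.torsionGaloisModule (p : ℤ)) (U ⊓ 𝔓.inertia (absoluteGaloisGroup ℚ)) →
      H1 (tateRep W p) (U ⊓ 𝔓.inertia (absoluteGaloisGroup ℚ)) :=
    fun r => if h : ∃ x, red x = r then h.choose else 0
  refine ⟨Finset.univ.image sec, fun x => ⟨sec (red x), Finset.mem_image_of_mem _ (Finset.mem_univ _),
    ?_⟩⟩
  have hex : ∃ x', red x' = red x := ⟨x, rfl⟩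
  have hsec : red (sec (red x)) = red x := by
    simp only [sec, dif_pos hex]
    exact hex.choose_spec
  have h0 : red (x - sec (red x)) = 0 := by rw [map_sub, hsec, sub_self]
  obtain ⟨z, hz⟩ := (reduceH1_eq_zero_iff W p _ _).mp h0
  exact ⟨z, hz.symm⟩

/-- **`M/p^m M` is finite** for every `m`, `M = H¹(U ⊓ I_𝔓, T_pW)`, `I_𝔓 ≤ U`, `𝔓 ∣ v ≠ p`: there is a
finite set `S ⊆ M` such that every `x ∈ M` satisfies `x - s = p^m • y` for some `s ∈ S`, `y ∈ M`
(induction on `m`: `x = s + p^m y`, `y = s' + p y'` give `x = (s + p^m s') + p^(m+1) y'`).  This is the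
finiteness of `H¹(K_v^{ur}/K_v, ·)`-cokernels used in the proof of Lemma 8.5 (2).
[cite: Kato2004Asterisque, Lemma 8.5 (2) (p. 184), proof] [cite: MilneADT2006, I §2 Lemma 2.9] -/
theorem exists_finset_forall_sub_eq_pow_smul {v : HeightOneSpectrum (𝓞 ℚ)}
    (hv : (p : 𝓞 ℚ) ∉ v.asIdeal) {𝔓 : Ideal (absIntegers (𝓞 ℚ) ℚ)} (h𝔓 : 𝔓 ∈ v.primesAbove)
    {U : Subgroup (absoluteGaloisGroup ℚ)} (hIU : 𝔓.inertia (absoluteGaloisGroup ℚ) ≤ U) (m : ℕ) :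
    ∃ S : Finset (H1 (tateRep W p) (U ⊓ 𝔓.inertia (absoluteGaloisGroup ℚ))),
      ∀ x, ∃ s ∈ S, ∃ y : H1 (tateRep W p) (U ⊓ 𝔓.inertia (absoluteGaloisGroup ℚ)),
        x - s = ((p : ℤ_[p]) ^ m) • y := by
  classical
  induction m with
  | zero =>
    refine ⟨{0}, fun x => ⟨0, Finset.mem_singleton_self _, x, ?_⟩⟩
    rw [sub_zero, pow_zero, one_smul]
  | succ m ih =>
    obtain ⟨S, hS⟩ := ih
    obtain ⟨S₁, hS₁⟩ := exists_finset_forall_sub_eq_smul W p hv h𝔓 hIU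
    refine ⟨(S ×ˢ S₁).image (fun q => q.1 + ((p : ℤ_[p]) ^ m) • q.2), fun x => ?_⟩
    obtain ⟨s, hs, y, hy⟩ := hS x
    obtain ⟨s', hs', y', hy'⟩ := hS₁ y
    refine ⟨s + ((p : ℤ_[p]) ^ m) • s', Finset.mem_image.mpr ⟨(s, s'), Finset.mk_mem_product hs hs', rfl⟩,
      y', ?_⟩
    have e1 : x - (s + ((p : ℤ_[p]) ^ m) • s') = ((p : ℤ_[p]) ^ m) • (y - s') := by
      rw [smul_sub, ← hy]; abel
    rw [e1, hy', ← mul_smul, ← pow_succ]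

end Literature.NumberTheory.EllipticCurves.Kato2004.UniversalNorms

end
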